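import Summits.KontsevichZagierPeriods.KontsevichZagierPeriods.Theorems.RootDecompQuadraticDescentSurdPairsP4

/-!
# Census pairs #1 #2 (ℚ(√−7) surd), #24 #28 (dilog), #36 #37 (weight one) DECIDED in `KZ.relations` (route `RootDecompQuadraticDescent`, instances of crux stmt-KontsevichZagierPeriods-28994 `DescentTwoQ` / stmt-4280 `KZDimTwo`) · part 5/6

Cell `decomp-kz`, lens 6 (decomp-kz-lens-6 g8): the LINEAR-FIBRE STRATUM of the weight-2 box census decided by rules 1+2 in dimension 2 — general lemma `linFibre` (unfolding `s = (α(x)y+β(x))/β(x)` into a log band) + ONE base substitution by the Möbius involution `κ(t) = (1−t)/(1+t)` (`rel_subst`) + `rel_trans`; `pair1`, `pair2` (the ℚ(√−7) live benchmarks of 28994 rev 7), `pair24`, `pair28`, `pair36`, `pair37` (the latter with four `RFun.stokes` steps, rational primitives); packaged `surdPairs_decided`, `surdPairs_descentTwoQ_instances` (∀ R ⊇ relations) and `surdPairs_of_kzDimTwo` BY NAME.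

Source: `HOME/decomp-kz-lens-6/g8/SurdPairs.lean` sha256 a3f0c2d08098ea3e (1516 l; critic decomp-kz-crit-1 g2 CLEARED 2026-08-30T08:39:24Z, std axioms), split into 6 modules by the landing seat decomp-kz-census-1 g7 (contexts re-opened per part; generic docstrings added where the source had none; the route file is imported only by the last part, which proves the `KZDimTwo` corollaries BY NAME).  No `sorry`; standard axioms.  References: [cite: KontsevichZagier2001, §1.2].
-/

noncomputable section

open MeasureTheory Set MvPolynomial

namespace Summit.KontsevichZagierPeriods.RootDecompQuadraticDescent.SurdPairs

open Literature.NumberTheory.Transcendental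
open Literature.NumberTheory.Transcendental.KZ
open Literature.ModelTheory.ExponentialFields (IsSemialgebraic)

-- PRIVATE copy (landed twins in farm-unbuilt HermiteRigidity/UnfoldedStokes modules; dedup.landed): update_one_apply_zero
/-- `update_one_apply_zero`: auxiliary theorem of the lens-6 development «surd» (instances of 28994/4280) — see the module docstring; verbatim from the lens file. -/
@[simp] private theorem update_one_apply_zero (x : Fin 2 → ℝ) (a : ℝ) : Function.update x 1 a 0 = x 0 :=
  Function.update_of_ne (by decide) a x

-- PRIVATE copy (twin landed in …DarkPairs; dedup.landed): rel_double
/-- `[2T] ≡ 2·[T]` on the square. -/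
private theorem rel_double (T T2 : RFun 2) (h : ∀ x ∈ cube 2, T2.fn x = T.fn x + T.fn x) :
    KZ.of T2.rep - 2 • KZ.of T.rep ∈ KZ.relations := by
  have h1 := rel_lin T2 T T h
  have : KZ.of T2.rep - 2 • KZ.of T.rep = KZ.of T2.rep - KZ.of T.rep - KZ.of T.rep := by abel
  rwa [this]

-- PRIVATE copy (landed twin lives in a farm-unbuilt module; dedup.landed): snoc2_zero, snoc2_one, init2_zero
/-- `snoc2_zero`: auxiliary theorem of the lens-6 development «surd» (instances of 28994/4280) — see the module docstring; verbatim from the lens file. -/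
@[simp] private theorem snoc2_zero (x : Fin 1 → ℝ) (t : ℝ) : (Fin.snoc x t : Fin 2 → ℝ) 0 = x 0 := rfl

/-- `snoc2_one`: auxiliary theorem of the lens-6 development «surd» (instances of 28994/4280) — see the module docstring; verbatim from the lens file. -/
@[simp] private theorem snoc2_one (x : Fin 1 → ℝ) (t : ℝ) : (Fin.snoc x t : Fin 2 → ℝ) 1 = t := rfl

/-- `init2_zero`: auxiliary theorem of the lens-6 development «surd» (instances of 28994/4280) — see the module docstring; verbatim from the lens file. -/
@[simp] private theorem init2_zero (z : Fin 2 → ℝ) : Fin.init z 0 = z 0 := rfl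

/-! ## §4d A weight-one pair by Stokes with RATIONAL primitives and two dyadic subdivisions:
census pair #37 (`W1/NONLINEAR · known · UNEXPLAINED by folds`),
`2·[□²,1/(1+x+2y)] − 3·[□²,1/(1+x+y)²] ∈ KZ.relations`.

Chain (14 moves of rules 1–3, every primitive a rational function, no logarithm ever written):
`[□²,2/(1+x+2y)] ≡ [□²,1/Q₁] + [□²,1/Q₂]` (`Q₁ = 1+x+y`, `Q₂ = 2+x+y`; dyadic subdivision along `y`);
`(2+x+y)/Q₁² = 1/Q₁ + 1/Q₁²`, `(1+x)/Q₁² = ∂_y (y/Q₁)`, `(1+y)/Q₁² ≡ (1+x)/Q₁²` (swap),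
`1/Q₁² = ∂_y(−1/Q₁)`, so `[□²,1/Q₁] ≡ 3·[□¹,1/(2+u)] − [□¹,1/(1+u)]`; likewise
`[□²,1/Q₂] ≡ 4·[□¹,1/(3+u)] − 2·[□¹,1/(2+u)]` and `[□²,1/Q₁²] ≡ [□¹,1/(1+u)] − [□¹,1/(2+u)]`; finally
`[□¹,1/(1+u)] ≡ [□¹,1/(2+u)] + [□¹,1/(3+u)]` (dyadic subdivision of the interval). -/

/-- The dyadic subdivision move along `xᵢ` (rules 1a + 2), any dimension.
[cite: KontsevichZagier2001, §1.2 rules (1), (2)] -/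
theorem rel_subdiv {M : ℕ} (i : Fin M) (A L U : RFun M)
    (hL : ∀ x ∈ cube M, L.fn x = (1 / 2 : ℝ) * A.fn (Function.update x i (x i / 2)))
    (hU : ∀ x ∈ cube M, U.fn x = (1 / 2 : ℝ) * A.fn (Function.update x i ((1 + x i) / 2))) :
    KZ.of A.rep - KZ.of L.rep - KZ.of U.rep ∈ KZ.relations :=
  KZ.cubicalSubdivGens_subset_relations (KZ.mem_cubicalSubdivGens A.isTameCube_rep
    L.isTameCube_rep U.isTameCube_rep i hL hU)

/-- `snoc1_zero`: auxiliary theorem of the lens-6 development «surd» (instances of 28994/4280) — see the module docstring; verbatim from the lens file. -/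
private theorem snoc1_zero (u : Fin 1 → ℝ) (c : ℝ) : (Fin.snoc u c : Fin 2 → ℝ) 0 = u 0 :=
  Fin.snoc_castSucc (α := fun _ => ℝ) (x := c) (p := u) (i := 0)
/-- `snoc1_one`: auxiliary theorem of the lens-6 development «surd» (instances of 28994/4280) — see the module docstring; verbatim from the lens file. -/
private theorem snoc1_one (u : Fin 1 → ℝ) (c : ℝ) : (Fin.snoc u c : Fin 2 → ℝ) 1 = c :=
  Fin.snoc_last (α := fun _ => ℝ) (x := c) (p := u)

/-- `Q₁ = 1 + x + y`, `Q₂ = 2 + x + y` (constants spelled `C 2` so that `pderiv` computes by `simp`). -/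
def Q1 : MvPolynomial (Fin 2) ℚ := 1 + X 0 + X 1
/-- `Q2`: auxiliary def of the lens-6 development «surd» (instances of 28994/4280) — see the module docstring; verbatim from the lens file. -/
def Q2 : MvPolynomial (Fin 2) ℚ := C 2 + X 0 + X 1
/-- `1 + x + 2y` and `1 + 2x + 2y + x² + 2xy + y² = (1+x+y)²` (census pair #37). -/
def QA37 : MvPolynomial (Fin 2) ℚ := 1 + X 0 + 2 * X 1
/-- `QB37`: auxiliary def of the lens-6 development «surd» (instances of 28994/4280) — see the module docstring; verbatim from the lens file. -/
def QB37 : MvPolynomial (Fin 2) ℚ := 1 + 2 * X 0 + 2 * X 1 + X 0 ^ 2 + 2 * X 0 * X 1 + X 1 ^ 2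

/-- `Q1_pos`: auxiliary theorem of the lens-6 development «surd» (instances of 28994/4280) — see the module docstring; verbatim from the lens file. -/
private theorem Q1_pos {x : Fin 2 → ℝ} (hx : x ∈ cube 2) : 0 < aeval x Q1 := by
  have h0 := (hx 0).1; have h1 := (hx 1).1
  simp only [Q1, map_add, map_one, aeval_X]; linarith
/-- `Q2_pos`: auxiliary theorem of the lens-6 development «surd» (instances of 28994/4280) — see the module docstring; verbatim from the lens file. -/
private theorem Q2_pos {x : Fin 2 → ℝ} (hx : x ∈ cube 2) : 0 < aeval x Q2 := by
  have h0 := (hx 0).1; have h1 := (hx 1).1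
  simp only [Q2, map_add, aeval_C, eq_ratCast, Rat.cast_ofNat, aeval_X]; linarith
/-- `QA37_pos`: auxiliary theorem of the lens-6 development «surd» (instances of 28994/4280) — see the module docstring; verbatim from the lens file. -/
private theorem QA37_pos {x : Fin 2 → ℝ} (hx : x ∈ cube 2) : 0 < aeval x QA37 := by
  have h0 := (hx 0).1; have h1 := (hx 1).1
  simp only [QA37, map_add, map_mul, map_ofNat, map_one, aeval_X]; linarith
/-- `QB37_pos`: auxiliary theorem of the lens-6 development «surd» (instances of 28994/4280) — see the module docstring; verbatim from the lens file. -/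
theorem QB37_pos {x : Fin 2 → ℝ} (hx : x ∈ cube 2) : 0 < aeval x QB37 := by
  have h0 := (hx 0).1; have h1 := (hx 1).1
  simp only [QB37, map_add, map_mul, map_pow, map_ofNat, map_one, aeval_X]
  nlinarith [mul_nonneg h0 h1, sq_nonneg (x 0), sq_nonneg (x 1)]
/-- `Q1sq_ne`: auxiliary theorem of the lens-6 development «surd» (instances of 28994/4280) — see the module docstring; verbatim from the lens file. -/
private theorem Q1sq_ne {x : Fin 2 → ℝ} (hx : x ∈ cube 2) : aeval x (Q1 * Q1) ≠ 0 := by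
  rw [map_mul]; exact mul_ne_zero (Q1_pos hx).ne' (Q1_pos hx).ne'
/-- `Q2sq_ne`: auxiliary theorem of the lens-6 development «surd» (instances of 28994/4280) — see the module docstring; verbatim from the lens file. -/
private theorem Q2sq_ne {x : Fin 2 → ℝ} (hx : x ∈ cube 2) : aeval x (Q2 * Q2) ≠ 0 := by
  rw [map_mul]; exact mul_ne_zero (Q2_pos hx).ne' (Q2_pos hx).ne'

/-- The census members `[□², 1/(1+x+2y)]` (and its double) and `[□², 1/(1+x+y)²]`. -/
def A37 : RFun 2 := ⟨1, QA37, fun _ hx => (QA37_pos hx).ne'⟩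
/-- `A37two`: auxiliary def of the lens-6 development «surd» (instances of 28994/4280) — see the module docstring; verbatim from the lens file. -/
def A37two : RFun 2 := ⟨2, QA37, fun _ hx => (QA37_pos hx).ne'⟩
/-- `B37`: auxiliary def of the lens-6 development «surd» (instances of 28994/4280) — see the module docstring; verbatim from the lens file. -/
def B37 : RFun 2 := ⟨1, QB37, fun _ hx => (QB37_pos hx).ne'⟩
/-- `[□², 1/Q₁]`, `[□², 1/Q₂]`, `[□², 1/Q₂²]`, `[□², 2/Q₂²]`. -/
def C1 : RFun 2 := ⟨1, Q1, fun _ hx => (Q1_pos hx).ne'⟩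
/-- `C2`: auxiliary def of the lens-6 development «surd» (instances of 28994/4280) — see the module docstring; verbatim from the lens file. -/
def C2 : RFun 2 := ⟨1, Q2, fun _ hx => (Q2_pos hx).ne'⟩
/-- `Bsq2`: auxiliary def of the lens-6 development «surd» (instances of 28994/4280) — see the module docstring; verbatim from the lens file. -/
def Bsq2 : RFun 2 := ⟨1, Q2 * Q2, fun _ hx => Q2sq_ne hx⟩
/-- `Bsq2two`: auxiliary def of the lens-6 development «surd» (instances of 28994/4280) — see the module docstring; verbatim from the lens file. -/
def Bsq2two : RFun 2 := ⟨2, Q2 * Q2, fun _ hx => Q2sq_ne hx⟩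
/-- The exact pieces `(1+x)/Q₁²`, `(1+y)/Q₁²`, `(2+x+y)/Q₁²` and their `Q₂` analogues. -/
def Ta1 : RFun 2 := ⟨1 + X 0, Q1 * Q1, fun _ hx => Q1sq_ne hx⟩
/-- `Tb1`: auxiliary def of the lens-6 development «surd» (instances of 28994/4280) — see the module docstring; verbatim from the lens file. -/
def Tb1 : RFun 2 := ⟨1 + X 1, Q1 * Q1, fun _ hx => Q1sq_ne hx⟩
/-- `S1`: auxiliary def of the lens-6 development «surd» (instances of 28994/4280) — see the module docstring; verbatim from the lens file. -/
def S1 : RFun 2 := ⟨C 2 + X 0 + X 1, Q1 * Q1, fun _ hx => Q1sq_ne hx⟩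
/-- `Ta2`: auxiliary def of the lens-6 development «surd» (instances of 28994/4280) — see the module docstring; verbatim from the lens file. -/
def Ta2 : RFun 2 := ⟨C 2 + X 0, Q2 * Q2, fun _ hx => Q2sq_ne hx⟩
/-- `Tb2`: auxiliary def of the lens-6 development «surd» (instances of 28994/4280) — see the module docstring; verbatim from the lens file. -/
def Tb2 : RFun 2 := ⟨C 2 + X 1, Q2 * Q2, fun _ hx => Q2sq_ne hx⟩
/-- `S2`: auxiliary def of the lens-6 development «surd» (instances of 28994/4280) — see the module docstring; verbatim from the lens file. -/
def S2 : RFun 2 := ⟨C 4 + X 0 + X 1, Q2 * Q2, fun _ hx => Q2sq_ne hx⟩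
/-- The rational primitives `y/Q₁`, `−1/Q₁`, `y/Q₂`, `−1/Q₂`. -/
def F1 : RFun 2 := ⟨X 1, Q1, fun _ hx => (Q1_pos hx).ne'⟩
/-- `F0`: auxiliary def of the lens-6 development «surd» (instances of 28994/4280) — see the module docstring; verbatim from the lens file. -/
def F0 : RFun 2 := ⟨-1, Q1, fun _ hx => (Q1_pos hx).ne'⟩
/-- `G1`: auxiliary def of the lens-6 development «surd» (instances of 28994/4280) — see the module docstring; verbatim from the lens file. -/
def G1 : RFun 2 := ⟨X 1, Q2, fun _ hx => (Q2_pos hx).ne'⟩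
/-- `G0`: auxiliary def of the lens-6 development «surd» (instances of 28994/4280) — see the module docstring; verbatim from the lens file. -/
def G0 : RFun 2 := ⟨-1, Q2, fun _ hx => (Q2_pos hx).ne'⟩
/-- The one-dimensional reps `[□¹, 1/(1+u)]`, `[□¹, 1/(2+u)]`, `[□¹, 1/(3+u)]`. -/
def D1 : RFun 1 := ⟨1, 1 + X 0, fun x hx => by
  have h := (hx 0).1; simp only [map_add, map_one, aeval_X]; exact (by linarith : (0:ℝ) < 1 + x 0).ne'⟩
/-- `D2`: auxiliary def of the lens-6 development «surd» (instances of 28994/4280) — see the module docstring; verbatim from the lens file. -/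
def D2 : RFun 1 := ⟨1, C 2 + X 0, fun x hx => by
  have h := (hx 0).1; simp only [map_add, aeval_C, eq_ratCast, Rat.cast_ofNat, aeval_X]
  exact (by linarith : (0:ℝ) < 2 + x 0).ne'⟩
/-- `D3`: auxiliary def of the lens-6 development «surd» (instances of 28994/4280) — see the module docstring; verbatim from the lens file. -/
def D3 : RFun 1 := ⟨1, C 3 + X 0, fun x hx => by
  have h := (hx 0).1; simp only [map_add, aeval_C, eq_ratCast, Rat.cast_ofNat, aeval_X]
  exact (by linarith : (0:ℝ) < 3 + x 0).ne'⟩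

/-- (e0) `[□², 2/(1+x+2y)] ≡ 2·[□², 1/(1+x+2y)]`. -/
theorem e37_0 : KZ.of A37two.rep - 2 • KZ.of A37.rep ∈ KZ.relations :=
  rel_double A37 A37two fun x _ => by simp only [RFun.fn, A37, A37two, map_one, map_ofNat]; ring

/-- (e1) dyadic subdivision along `y`: `[□², 2/(1+x+2y)] ≡ [□², 1/(1+x+y)] + [□², 1/(2+x+y)]`. -/
theorem e37_1 : KZ.of A37two.rep - KZ.of C1.rep - KZ.of C2.rep ∈ KZ.relations := by
  refine rel_subdiv 1 A37two C1 C2 (fun x hx => ?_) (fun x hx => ?_)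
  · have h0 := (hx 0).1; have h1 := (hx 1).1
    have hq : (1:ℝ) + x 0 + x 1 ≠ 0 := by linarith
    simp only [RFun.fn, C1, A37two, Q1, QA37, map_add, map_mul, map_ofNat, map_one, aeval_X,
      Function.update_self, update_one_apply_zero]
    field_simp
    try ring
  · have h0 := (hx 0).1; have h1 := (hx 1).1
    have hq : (2:ℝ) + x 0 + x 1 ≠ 0 := by linarith
    simp only [RFun.fn, C2, A37two, Q2, QA37, map_add, map_mul, map_ofNat, map_one, aeval_X,
      Function.update_self, update_one_apply_zero]
    field_simp
    try ring

/-- (e2) `(2+x+y)/Q₁² = (1+x)/Q₁² + (1+y)/Q₁²`. -/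
theorem e37_2 : KZ.of S1.rep - KZ.of Ta1.rep - KZ.of Tb1.rep ∈ KZ.relations :=
  rel_lin S1 Ta1 Tb1 fun x hx => by
    simp only [RFun.fn, S1, Ta1, Tb1, map_add, map_one, aeval_X, aeval_C, eq_ratCast, Rat.cast_ofNat]
    ring

/-- (e3) `(2+x+y)/Q₁² = 1/Q₁ + 1/(1+x+y)²`. -/
theorem e37_3 : KZ.of S1.rep - KZ.of C1.rep - KZ.of B37.rep ∈ KZ.relations :=
  rel_lin S1 C1 B37 fun x hx => by
    have hq := (Q1_pos hx).ne'
    simp only [Q1, map_add, map_one, aeval_X] at hq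
    simp only [RFun.fn, S1, C1, B37, Q1, QB37, map_add, map_mul, map_pow, map_ofNat, map_one, aeval_X]
    have hq2 : (1:ℝ) + 2 * x 0 + 2 * x 1 + x 0 ^ 2 + 2 * x 0 * x 1 + x 1 ^ 2 ≠ 0 := by
      have : (1:ℝ) + 2 * x 0 + 2 * x 1 + x 0 ^ 2 + 2 * x 0 * x 1 + x 1 ^ 2 = (1 + x 0 + x 1) ^ 2 := by ring
      rw [this]; exact pow_ne_zero 2 hq
    field_simp
    try ring

/-- (e5) `(1+y)/Q₁² ≡ (1+x)/Q₁²` by the swap `x ↔ y`. -/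
theorem e37_5 : KZ.of Ta1.rep - KZ.of Tb1.rep ∈ KZ.relations := by
  have h := add_mem (RFun.rel_rename Ta1 (Equiv.swap 0 1))
    (RFun.rel_of_eqOn (T := Ta1.rename (Equiv.swap 0 1)) (S := Tb1) fun x hx => by
      rw [RFun.fn_rename]
      simp only [RFun.fn, Ta1, Tb1, Q1, map_add, map_mul, map_one, aeval_X, Function.comp_apply,
        Equiv.swap_apply_left, Equiv.swap_apply_right]
      ring)
  convert h using 1
  abel

/-- (e4) Stokes with the primitive `y/Q₁`: `[□², (1+x)/Q₁²] ≡ [□¹, 1/(2+u)]`. -/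
theorem e37_4 : KZ.of Ta1.rep - KZ.of D2.rep ∈ KZ.relations := by
  have hst := RFun.stokes F1
  have hd : KZ.of Ta1.rep - KZ.of F1.dlast.rep ∈ KZ.relations := RFun.rel_of_eqOn fun y hy => by
    have hq := (Q1_pos hy).ne'
    simp only [Q1, map_add, map_one, aeval_X] at hq
    simp only [RFun.fn, RFun.dlast, Ta1, F1, Q1, map_add, map_sub, map_mul, map_pow, map_one, aeval_X,
      pderiv_X, Derivation.map_one_eq_zero, Pi.single_apply]
    rw [div_eq_div_iff (mul_ne_zero hq hq) (pow_ne_zero 2 hq)]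
    norm_num [Fin.ext_iff]
    left; ring
  have hf1 : KZ.of (F1.face 1 ⟨zero_le_one, le_rfl⟩).rep - KZ.of D2.rep ∈ KZ.relations :=
    RFun.rel_of_eqOn fun u hu => by
      rw [RFun.fn_face]
      simp only [RFun.fn, F1, D2, Q1, map_add, map_one, aeval_X, aeval_C, eq_ratCast, Rat.cast_ofNat,
        Rat.cast_one, snoc1_zero, snoc1_one]
      ring
  have hf0 : KZ.of (F1.face 0 ⟨le_rfl, zero_le_one⟩).rep ∈ KZ.relations :=
    RFun.rel_of_eqOn_zero fun u hu => by
      rw [RFun.fn_face]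
      simp only [RFun.fn, F1, Q1, map_add, map_one, aeval_X, Rat.cast_zero, snoc1_zero, snoc1_one]
      simp
  have h := sub_mem (add_mem (add_mem hd hst) hf1) hf0
  convert h using 1
  abel

/-- (e6) Stokes with the primitive `−1/Q₁`: `[□², 1/(1+x+y)²] ≡ [□¹, 1/(1+u)] − [□¹, 1/(2+u)]`. -/
theorem e37_6 : KZ.of B37.rep - KZ.of D1.rep + KZ.of D2.rep ∈ KZ.relations := by
  have hst := RFun.stokes F0
  have hd : KZ.of B37.rep - KZ.of F0.dlast.rep ∈ KZ.relations := RFun.rel_of_eqOn fun y hy => by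
    have hq := (Q1_pos hy).ne'
    simp only [Q1, map_add, map_one, aeval_X] at hq
    have hq2 : (1:ℝ) + 2 * y 0 + 2 * y 1 + y 0 ^ 2 + 2 * y 0 * y 1 + y 1 ^ 2 ≠ 0 := by
      have : (1:ℝ) + 2 * y 0 + 2 * y 1 + y 0 ^ 2 + 2 * y 0 * y 1 + y 1 ^ 2 = (1 + y 0 + y 1) ^ 2 := by ring
      rw [this]; exact pow_ne_zero 2 hq
    simp only [RFun.fn, RFun.dlast, B37, F0, Q1, QB37, map_add, map_sub, map_mul, map_pow, map_one,
      map_neg, map_ofNat, aeval_X, pderiv_X, Derivation.map_one_eq_zero, Pi.single_apply]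
    rw [div_eq_div_iff hq2 (pow_ne_zero 2 hq)]
    norm_num [Fin.ext_iff]
    try ring
  have hf1 : KZ.of (F0.face 1 ⟨zero_le_one, le_rfl⟩).rep - KZ.of D2.neg.rep ∈ KZ.relations :=
    RFun.rel_of_eqOn fun u hu => by
      rw [RFun.fn_face, RFun.fn_neg]
      simp only [RFun.fn, F0, D2, Q1, map_add, map_one, map_neg, aeval_X, aeval_C, eq_ratCast,
        Rat.cast_ofNat, Rat.cast_one, snoc1_zero, snoc1_one]
      ring
  have hf0 : KZ.of (F0.face 0 ⟨le_rfl, zero_le_one⟩).rep - KZ.of D1.neg.rep ∈ KZ.relations :=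
    RFun.rel_of_eqOn fun u hu => by
      rw [RFun.fn_face, RFun.fn_neg]
      simp only [RFun.fn, F0, D1, Q1, map_add, map_one, map_neg, aeval_X, Rat.cast_zero, snoc1_zero,
        snoc1_one]
      ring
  have h := sub_mem (add_mem (sub_mem (add_mem (add_mem hd hst) hf1) hf0) (RFun.rel_neg D2))
    (RFun.rel_neg D1)
  convert h using 1
  abel

/-- (e2′) `(4+x+y)/Q₂² = (2+x)/Q₂² + (2+y)/Q₂²`. -/
theorem e37_2' : KZ.of S2.rep - KZ.of Ta2.rep - KZ.of Tb2.rep ∈ KZ.relations :=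
  rel_lin S2 Ta2 Tb2 fun x hx => by
    simp only [RFun.fn, S2, Ta2, Tb2, map_add, aeval_X, aeval_C, eq_ratCast, Rat.cast_ofNat]
    ring

/-- (e3′) `(4+x+y)/Q₂² = 1/Q₂ + 2/Q₂²`. -/
theorem e37_3' : KZ.of S2.rep - KZ.of C2.rep - KZ.of Bsq2two.rep ∈ KZ.relations :=
  rel_lin S2 C2 Bsq2two fun x hx => by
    have hq := (Q2_pos hx).ne'
    simp only [Q2, map_add, aeval_C, eq_ratCast, Rat.cast_ofNat, aeval_X] at hq
    simp only [RFun.fn, S2, C2, Bsq2two, Q2, map_add, map_mul, map_ofNat, map_one, aeval_X]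
    field_simp
    try ring

/-- (e5′) `(2+y)/Q₂² ≡ (2+x)/Q₂²` by the swap. -/
theorem e37_5' : KZ.of Ta2.rep - KZ.of Tb2.rep ∈ KZ.relations := by
  have h := add_mem (RFun.rel_rename Ta2 (Equiv.swap 0 1))
    (RFun.rel_of_eqOn (T := Ta2.rename (Equiv.swap 0 1)) (S := Tb2) fun x hx => by
      rw [RFun.fn_rename]
      simp only [RFun.fn, Ta2, Tb2, Q2, map_add, map_mul, aeval_X, aeval_C, eq_ratCast, Rat.cast_ofNat,
        Function.comp_apply, Equiv.swap_apply_left, Equiv.swap_apply_right]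
      ring)
  convert h using 1
  abel

/-- (e4′) Stokes with the primitive `y/Q₂`: `[□², (2+x)/Q₂²] ≡ [□¹, 1/(3+u)]`. -/
theorem e37_4' : KZ.of Ta2.rep - KZ.of D3.rep ∈ KZ.relations := by
  have hst := RFun.stokes G1
  have hd : KZ.of Ta2.rep - KZ.of G1.dlast.rep ∈ KZ.relations := RFun.rel_of_eqOn fun y hy => by
    have hq := (Q2_pos hy).ne'
    simp only [Q2, map_add, aeval_C, eq_ratCast, Rat.cast_ofNat, aeval_X] at hq
    simp only [RFun.fn, RFun.dlast, Ta2, G1, Q2, map_add, map_sub, map_mul, map_pow, aeval_X, aeval_C,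
      eq_ratCast, Rat.cast_ofNat, pderiv_X, pderiv_C, Pi.single_apply]
    rw [div_eq_div_iff (mul_ne_zero hq hq) (pow_ne_zero 2 hq)]
    norm_num [Fin.ext_iff]
    left; ring
  have hf1 : KZ.of (G1.face 1 ⟨zero_le_one, le_rfl⟩).rep - KZ.of D3.rep ∈ KZ.relations :=
    RFun.rel_of_eqOn fun u hu => by
      rw [RFun.fn_face]
      simp only [RFun.fn, G1, D3, Q2, map_add, map_one, aeval_X, aeval_C, eq_ratCast, Rat.cast_ofNat,
        Rat.cast_one, snoc1_zero, snoc1_one]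
      ring
  have hf0 : KZ.of (G1.face 0 ⟨le_rfl, zero_le_one⟩).rep ∈ KZ.relations :=
    RFun.rel_of_eqOn_zero fun u hu => by
      rw [RFun.fn_face]
      simp only [RFun.fn, G1, Q2, map_add, aeval_X, aeval_C, eq_ratCast, Rat.cast_ofNat, Rat.cast_zero,
        snoc1_zero, snoc1_one]
      simp
  have h := sub_mem (add_mem (add_mem hd hst) hf1) hf0
  convert h using 1
  abel

/-- (e6′) Stokes with the primitive `−1/Q₂`: `[□², 1/Q₂²] ≡ [□¹, 1/(2+u)] − [□¹, 1/(3+u)]`. -/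
theorem e37_6' : KZ.of Bsq2.rep - KZ.of D2.rep + KZ.of D3.rep ∈ KZ.relations := by
  have hst := RFun.stokes G0
  have hd : KZ.of Bsq2.rep - KZ.of G0.dlast.rep ∈ KZ.relations := RFun.rel_of_eqOn fun y hy => by
    have hq := (Q2_pos hy).ne'
    simp only [Q2, map_add, aeval_C, eq_ratCast, Rat.cast_ofNat, aeval_X] at hq
    simp only [RFun.fn, RFun.dlast, Bsq2, G0, Q2, map_add, map_sub, map_mul, map_pow, map_one, map_neg,
      aeval_X, aeval_C, eq_ratCast, Rat.cast_ofNat, pderiv_X, pderiv_C, Pi.single_apply]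
    rw [div_eq_div_iff (mul_ne_zero hq hq) (pow_ne_zero 2 hq)]
    norm_num [Fin.ext_iff]
    ring
  have hf1 : KZ.of (G0.face 1 ⟨zero_le_one, le_rfl⟩).rep - KZ.of D3.neg.rep ∈ KZ.relations :=
    RFun.rel_of_eqOn fun u hu => by
      rw [RFun.fn_face, RFun.fn_neg]
      simp only [RFun.fn, G0, D3, Q2, map_add, map_one, map_neg, aeval_X, aeval_C, eq_ratCast,
        Rat.cast_ofNat, Rat.cast_one, snoc1_zero, snoc1_one]
      ring
  have hf0 : KZ.of (G0.face 0 ⟨le_rfl, zero_le_one⟩).rep - KZ.of D2.neg.rep ∈ KZ.relations :=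
    RFun.rel_of_eqOn fun u hu => by
      rw [RFun.fn_face, RFun.fn_neg]
      simp only [RFun.fn, G0, D2, Q2, map_add, map_one, map_neg, aeval_X, aeval_C, eq_ratCast,
        Rat.cast_ofNat, Rat.cast_zero, snoc1_zero, snoc1_one]
      ring
  have h := sub_mem (add_mem (sub_mem (add_mem (add_mem hd hst) hf1) hf0) (RFun.rel_neg D3))
    (RFun.rel_neg D2)
  convert h using 1
  abel

/-- (e7′) `[□², 2/Q₂²] ≡ 2·[□², 1/Q₂²]`. -/
theorem e37_7' : KZ.of Bsq2two.rep - 2 • KZ.of Bsq2.rep ∈ KZ.relations :=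
  rel_double Bsq2 Bsq2two fun x _ => by simp only [RFun.fn, Bsq2, Bsq2two, map_one, map_ofNat]; ring

end Summit.KontsevichZagierPeriods.RootDecompQuadraticDescent.SurdPairs

end
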